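/-
Copyright: the b2b-balaban T⁴-continuum CRUX team, row NE7b OWNER lineage `t4-ne7b-p1` (gen 141). Project licence.
-/
import Summits.QuantumFields.BalabanUV.T4Continuum.Spine.NE7b.SupDobrushinGroupCovariance

/-!
# TRUNCATION ACROSS A `1|3` CUT: ONE FREE FACTOR AGAINST A TRIPLE CLAMPED PRODUCT (SCOPING (d13)(2), fifth file).  For the bipartitions
# `{i}|{j,k,l}` of four sites the cut covariance is `Cov(f̃_i, f̃_jf̃_kf̃_l) = E[f̃₁f̃₂f̃₃f̃₄]` (centred `f̃_i`); clamping the THREE factors of the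
# product makes it Lipschitz with vector `R²(a_j+a_k+a_l)` ((489) `clamped_triple_lipVec`), Dobrushin gives `R²·Σ_w(Dᵀa_i)_w(Dᵀ(a_j+a_k+a_l))_w∕c_w`
# ((489) `single_clamped_triple_cov_le`), and THIS FILE prices the defect of the three clamps against the free factor:
#   `|bcd − T_Rb·T_Rc·T_Rd| ≤ (b²|c||d| + |b|c²|d| + |b||c|d²)∕R`,  `|a|·(that) ≤ (Σa⁴ + Σa⁶)∕R`   ((486)'s arithmetic–geometric means),
# so with `f₁ = F₁ − E_νF₁` (TRUE mean: `E f₁ = 0`) and arbitrary centrings of the other three,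
#   `|∫f₁f₂f₃f₄ dν| ≤ R²·Σ_w(Dᵀa₁)_w((Dᵀa₂)_w+(Dᵀa₃)_w+(Dᵀa₄)_w)∕c_w + (ΣM₄ + ΣM₆)∕R`   for every `R > 0`
# — the `1|3` companion of (489)'s `2|2` bound; together they supply all SEVEN cut bounds of (487) (row NE7b, node U5c; (486), (489) BY NAME;
# [folklore])

Cell `pub-balaban`, sub-cell `t4`, spine estimate NE7b (`T4WeightBudget.RelWeightBound`; the cell's OWN estimate — NOT PRINTED in
[Bałaban 1983–89], NOT PROVED).  Crux-route work under `Spine/NE7b/` by the row OWNER (`t4-ne7b-p1` gen 141, file (490)) under FREEZE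
(0)'s crux-prover clause; NOTHING of Bałaban's is named as a Lean object, valued or asserted; no `T4Continuum/Support` leaf typed; no
`def`, no notation; zero `sorry`.  Imports (BY NAME): the OWNER's (489) `…SupDobrushinGroupCovariance` (`single_clamped_triple_cov_le`; through it
(486) `sq_mul_abs_three_le`, `abs_quad_le`, (461), (447), (445)∕(446)).

WHAT IS PROVED ([folklore]):
* §1 pointwise: `triple_sub_clamp_triple_abs_le`, `abs_mul_triple_defect_le`.
* §2 expectations (probability measure): `integrable_single_clamped`, `single_expect_defect_le` (`|∫f₁f₂f₃f₄ − ∫f₁T_Rf₂T_Rf₃T_Rf₄| ≤ (ΣM₄+ΣM₆)∕R`).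
* §3 THE END **`group_cov_one_three_le`** (the `1|3` cut bound under the Gibbs law); §4 toy.

HONEST (what this is NOT).  The `1|3` cut; the sixth centred moments (Poincaré), the per-cut assembly with the weights (choosing `R` a power of
`ρ`, (466)'s decay of `B`, the pairings by (457)'s entries) into (487)'s seven hypotheses and the `u₄` kernel letter are the next files; the
cumulant form of `∂⁴W` NOT typed; scalar skeleton ((A3), NC-NE7b-α UNRULED); nothing of Bałaban's asserted.  BY-NAME EFFECT ON THE WALL: NONE.
NE7b NOT PRINTED ∕ NOT PROVED; spine PROVED 0∕9; rung (B)+1 — the programme's measures remain FINITE-torus statements; NOT the mass gap, NOT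
Clay.  HONEST DEPENDENCY: continuum YM on T⁴ ⇐ BetaPertH ∧ nine spine estimates (0∕9 proved); BetaPertH ⇐ (D1) ∧ (D4) ∧ CAP+tail; G-an2-4
gates asym, D1 and NE2∕3∕4.
-/

set_option autoImplicit false

noncomputable section

namespace Summit.QuantumFields.BalabanUV.T4Continuum.NE7b.SupTruncationSingleCut

open MeasureTheory Real Set Function Finset
open scoped BigOperators
open SupOneSiteResamplingInvariance (memLp_coord_tilted)
open SupTruncationGroupBound (sq_mul_abs_three_le abs_quad_le)
open SupDobrushinGroupCovariance (clamped_triple_lipVec single_clamped_triple_cov_le)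

/-! ## §1. Pointwise: three clamps against a free factor -/

/-- **The three-factor clamp defect**: `|bcd − T_Rb·T_Rc·T_Rd| ≤ (b²|c||d| + |b|c²|d| + |b||c|d²)∕R` (`R > 0`). [folklore] -/
theorem triple_sub_clamp_triple_abs_le {R : ℝ} (hR : 0 < R) (b c d : ℝ) :
    |b * c * d - max (-R) (min R b) * max (-R) (min R c) * max (-R) (min R d)| ≤ (b ^ 2 * |c| * |d| + |b| * c ^ 2 * |d| + |b| * |c| * d ^ 2) / R := by
  have hshrink : ∀ w : ℝ, |max (-R) (min R w)| ≤ |w| := fun w => by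
    rcases le_or_gt w (-R) with h1 | h1
    · rw [min_eq_right (by linarith), max_eq_left h1, abs_of_nonpos (by linarith), abs_of_nonpos (by linarith)]; linarith
    · rcases le_or_gt w R with h2 | h2
      · rw [min_eq_right h2, max_eq_right h1.le]
      · rw [min_eq_left h2.le, max_eq_right (by linarith), abs_of_nonneg hR.le, abs_of_pos (by linarith)]; linarith
  have hdef : ∀ w : ℝ, |w - max (-R) (min R w)| * R ≤ w ^ 2 := fun w => by
    rcases le_or_gt w (-R) with h1 | h1
    · rw [min_eq_right (by linarith), max_eq_left h1, abs_of_nonpos (by linarith)]; nlinarith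
    · rcases le_or_gt w R with h2 | h2
      · rw [min_eq_right h2, max_eq_right h1.le, sub_self, abs_zero, zero_mul]; positivity
      · rw [min_eq_left h2.le, max_eq_right (by linarith), abs_of_nonneg (by linarith)]; nlinarith
  set B := max (-R) (min R b) with hB
  set C := max (-R) (min R c) with hC
  set D := max (-R) (min R d) with hD
  have e : b * c * d - B * C * D = (b - B) * c * d + B * (c - C) * d + B * C * (d - D) := by ring
  rw [e, le_div_iff₀ hR]
  have t1 : |(b - B) * c * d| * R ≤ b ^ 2 * |c| * |d| := by
    rw [abs_mul ((b - B) * c) d, abs_mul (b - B) c]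
    have h := hdef b
    have hnn : 0 ≤ |c| * |d| := by positivity
    nlinarith
  have t2 : |B * (c - C) * d| * R ≤ |b| * c ^ 2 * |d| := by
    rw [abs_mul (B * (c - C)) d, abs_mul B (c - C)]
    have h := hdef c
    have h' : |B| * |d| ≤ |b| * |d| := mul_le_mul_of_nonneg_right (hshrink b) (abs_nonneg _)
    have hnn : 0 ≤ |B| * |d| := by positivity
    nlinarith [abs_nonneg (c - C)]
  have t3 : |B * C * (d - D)| * R ≤ |b| * |c| * d ^ 2 := by
    rw [abs_mul (B * C) (d - D), abs_mul B C]
    have h := hdef d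
    have h' : |B| * |C| ≤ |b| * |c| := mul_le_mul (hshrink b) (hshrink c) (abs_nonneg _) (abs_nonneg _)
    have hnn : 0 ≤ |B| * |C| := by positivity
    nlinarith [abs_nonneg (d - D)]
  have tri : |(b - B) * c * d + B * (c - C) * d + B * C * (d - D)| ≤ |(b - B) * c * d| + |B * (c - C) * d| + |B * C * (d - D)| := by
    have h1 := abs_add_le ((b - B) * c * d + B * (c - C) * d) (B * C * (d - D))
    have h2 := abs_add_le ((b - B) * c * d) (B * (c - C) * d)
    linarith
  nlinarith [tri, t1, t2, t3, hR]

/-- **The free factor against the three-clamp defect**: `|a|·|bcd − T_Rb·T_Rc·T_Rd| ≤ ((a⁴+b⁴+c⁴+d⁴) + (a⁶+b⁶+c⁶+d⁶))∕R`. [folklore] -/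
theorem abs_mul_triple_defect_le {R : ℝ} (hR : 0 < R) (a b c d : ℝ) :
    |a| * |b * c * d - max (-R) (min R b) * max (-R) (min R c) * max (-R) (min R d)| ≤
      ((a ^ 4 + b ^ 4 + c ^ 4 + d ^ 4) + (a ^ 6 + b ^ 6 + c ^ 6 + d ^ 6)) / R := by
  have h0 := triple_sub_clamp_triple_abs_le hR b c d
  have s1 := sq_mul_abs_three_le b a c d
  have s2 := sq_mul_abs_three_le c a b d
  have s3 := sq_mul_abs_three_le d a b c
  have ha6 : 0 ≤ a ^ 6 := by positivity
  calc |a| * |b * c * d - max (-R) (min R b) * max (-R) (min R c) * max (-R) (min R d)|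
      ≤ |a| * ((b ^ 2 * |c| * |d| + |b| * c ^ 2 * |d| + |b| * |c| * d ^ 2) / R) := mul_le_mul_of_nonneg_left h0 (abs_nonneg a)
    _ = (b ^ 2 * |a| * |c| * |d| + c ^ 2 * |a| * |b| * |d| + d ^ 2 * |a| * |b| * |c|) / R := by rw [mul_div_assoc']; ring_nf
    _ ≤ ((a ^ 4 + b ^ 4 + c ^ 4 + d ^ 4) + (a ^ 6 + b ^ 6 + c ^ 6 + d ^ 6)) / R := by
        refine div_le_div_of_nonneg_right ?_ hR.le
        nlinarith [s1, s2, s3, ha6, sq_nonneg (a ^ 2), sq_nonneg (b ^ 2), sq_nonneg (c ^ 2), sq_nonneg (d ^ 2)]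

/-! ## §2. Expectations under a probability measure -/

section Expect

variable {Ω : Type*} [MeasurableSpace Ω] {μ : Measure Ω} {f g h k : Ω → ℝ}

/-- **`f₁·T_Rf₂·T_Rf₃·T_Rf₄` is integrable** (`|T_Ru| ≤ |u|`, `|abcd| ≤ Σa⁴∕4`). [folklore] -/
theorem integrable_single_clamped [IsProbabilityMeasure μ] (hf : Measurable f) (hg : Measurable g) (hh : Measurable h) (hk : Measurable k) {R : ℝ}
    (hR : 0 ≤ R) (hf4 : Integrable (fun ω => f ω ^ 4) μ) (hg4 : Integrable (fun ω => g ω ^ 4) μ) (hh4 : Integrable (fun ω => h ω ^ 4) μ)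
    (hk4 : Integrable (fun ω => k ω ^ 4) μ) :
    Integrable (fun ω => f ω * (max (-R) (min R (g ω)) * max (-R) (min R (h ω)) * max (-R) (min R (k ω)))) μ := by
  have hm : ∀ {φ : Ω → ℝ}, Measurable φ → Measurable fun ω => max (-R) (min R (φ ω)) := fun hφ => measurable_const.max (measurable_const.min hφ)
  have hshrink : ∀ w : ℝ, |max (-R) (min R w)| ≤ |w| := fun w => by
    rcases le_or_gt w (-R) with h1 | h1
    · rw [min_eq_right (by linarith), max_eq_left h1, abs_of_nonpos (by linarith), abs_of_nonpos (by linarith)]; linarith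
    · rcases le_or_gt w R with h2 | h2
      · rw [min_eq_right h2, max_eq_right h1.le]
      · rw [min_eq_left h2.le, max_eq_right (by linarith), abs_of_nonneg hR, abs_of_pos (by linarith)]; linarith
  have h4s : Integrable (fun ω => (f ω ^ 4 + g ω ^ 4 + h ω ^ 4 + k ω ^ 4) / 4) μ := (((hf4.add hg4).add hh4).add hk4).div_const 4
  refine h4s.mono' (hf.mul (((hm hg).mul (hm hh)).mul (hm hk))).aestronglyMeasurable (ae_of_all _ fun ω => ?_)
  rw [Real.norm_eq_abs, abs_mul, abs_mul, abs_mul]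
  have hq := abs_quad_le (f ω) (g ω) (h ω) (k ω)
  rw [abs_mul, abs_mul, abs_mul] at hq
  have h1 := hshrink (g ω); have h2 := hshrink (h ω); have h3 := hshrink (k ω)
  have hprod : |f ω| * (|max (-R) (min R (g ω))| * |max (-R) (min R (h ω))| * |max (-R) (min R (k ω))|) ≤ |f ω| * (|g ω| * |h ω| * |k ω|) :=
    mul_le_mul_of_nonneg_left (mul_le_mul (mul_le_mul h1 h2 (abs_nonneg _) (abs_nonneg _)) h3 (abs_nonneg _) (by positivity)) (abs_nonneg _)
  calc |f ω| * (|max (-R) (min R (g ω))| * |max (-R) (min R (h ω))| * |max (-R) (min R (k ω))|) ≤ |f ω| * (|g ω| * |h ω| * |k ω|) := hprod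
    _ = |f ω| * |g ω| * |h ω| * |k ω| := by ring
    _ ≤ (f ω ^ 4 + g ω ^ 4 + h ω ^ 4 + k ω ^ 4) / 4 := hq

/-- **The `1|3` defect in expectation**: `|∫f₁f₂f₃f₄ − ∫f₁·T_Rf₂T_Rf₃T_Rf₄| ≤ (Σ∫f⁴ + Σ∫f⁶)∕R`. [folklore] -/
theorem single_expect_defect_le [IsProbabilityMeasure μ] (hf : Measurable f) (hg : Measurable g) (hh : Measurable h) (hk : Measurable k) {R : ℝ}
    (hR : 0 < R) (hf4 : Integrable (fun ω => f ω ^ 4) μ) (hg4 : Integrable (fun ω => g ω ^ 4) μ) (hh4 : Integrable (fun ω => h ω ^ 4) μ)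
    (hk4 : Integrable (fun ω => k ω ^ 4) μ) (hf6 : Integrable (fun ω => f ω ^ 6) μ) (hg6 : Integrable (fun ω => g ω ^ 6) μ)
    (hh6 : Integrable (fun ω => h ω ^ 6) μ) (hk6 : Integrable (fun ω => k ω ^ 6) μ) :
    |(∫ ω, f ω * g ω * h ω * k ω ∂μ) - ∫ ω, f ω * (max (-R) (min R (g ω)) * max (-R) (min R (h ω)) * max (-R) (min R (k ω))) ∂μ| ≤
      (((∫ ω, f ω ^ 4 ∂μ) + (∫ ω, g ω ^ 4 ∂μ) + (∫ ω, h ω ^ 4 ∂μ) + (∫ ω, k ω ^ 4 ∂μ)) +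
        ((∫ ω, f ω ^ 6 ∂μ) + (∫ ω, g ω ^ 6 ∂μ) + (∫ ω, h ω ^ 6 ∂μ) + (∫ ω, k ω ^ 6 ∂μ))) / R := by
  have hI := SupTruncationGroupBound.integrable_quad hf hg hh hk hf4 hg4 hh4 hk4
  have hIT := integrable_single_clamped hf hg hh hk hR.le hf4 hg4 hh4 hk4
  rw [← integral_sub hI hIT]
  have h4a : Integrable (fun ω => f ω ^ 4 + g ω ^ 4) μ := hf4.add hg4
  have h4b : Integrable (fun ω => f ω ^ 4 + g ω ^ 4 + h ω ^ 4) μ := h4a.add hh4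
  have h4c : Integrable (fun ω => f ω ^ 4 + g ω ^ 4 + h ω ^ 4 + k ω ^ 4) μ := h4b.add hk4
  have h6a : Integrable (fun ω => f ω ^ 6 + g ω ^ 6) μ := hf6.add hg6
  have h6b : Integrable (fun ω => f ω ^ 6 + g ω ^ 6 + h ω ^ 6) μ := h6a.add hh6
  have h6c : Integrable (fun ω => f ω ^ 6 + g ω ^ 6 + h ω ^ 6 + k ω ^ 6) μ := h6b.add hk6
  have h46 : Integrable (fun ω => (f ω ^ 4 + g ω ^ 4 + h ω ^ 4 + k ω ^ 4) + (f ω ^ 6 + g ω ^ 6 + h ω ^ 6 + k ω ^ 6)) μ := h4c.add h6c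
  have hbound : Integrable (fun ω => ((f ω ^ 4 + g ω ^ 4 + h ω ^ 4 + k ω ^ 4) + (f ω ^ 6 + g ω ^ 6 + h ω ^ 6 + k ω ^ 6)) / R) μ := h46.div_const R
  have hdom : ∀ ω, |f ω * g ω * h ω * k ω - f ω * (max (-R) (min R (g ω)) * max (-R) (min R (h ω)) * max (-R) (min R (k ω)))| ≤
      ((f ω ^ 4 + g ω ^ 4 + h ω ^ 4 + k ω ^ 4) + (f ω ^ 6 + g ω ^ 6 + h ω ^ 6 + k ω ^ 6)) / R := fun ω => by
    have e : f ω * g ω * h ω * k ω - f ω * (max (-R) (min R (g ω)) * max (-R) (min R (h ω)) * max (-R) (min R (k ω))) =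
        f ω * (g ω * h ω * k ω - max (-R) (min R (g ω)) * max (-R) (min R (h ω)) * max (-R) (min R (k ω))) := by ring
    rw [e, abs_mul]
    exact abs_mul_triple_defect_le hR (f ω) (g ω) (h ω) (k ω)
  refine (abs_integral_le_integral_abs).trans ((integral_mono_of_nonneg (ae_of_all _ fun ω => abs_nonneg _) hbound
    (ae_of_all _ hdom)).trans (le_of_eq ?_))
  rw [integral_div, integral_add h4c h6c, integral_add h4b hk4, integral_add h4a hh4, integral_add hf4 hg4, integral_add h6b hk6,
    integral_add h6a hh6, integral_add hf6 hg6]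

end Expect

/-! ## §3. THE END: the `1|3` cut bound under the Gibbs law -/

variable {ι : Type} [Fintype ι] [DecidableEq ι]

variable {V : (ι → ℝ) → ℝ} {V₁ : ι → (ι → ℝ) → ℝ} {c : ι → ℝ} {Cw γ : ℝ} {J D : ι → ι → ℝ}
  {P : ι → ((ι → ℝ) → ℝ) → ((ι → ℝ) → ℝ)} {F₁ F₂ F₃ F₄ : (ι → ℝ) → ℝ} {a₁ a₂ a₃ a₄ : ι → ℝ}

/-- **THE END — THE `1|3` GROUP BOUND UNDER THE GIBBS LAW**: with `f₁ = F₁ − E_νF₁` (true mean) and arbitrary centrings `m₂, m₃, m₄`,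
fourth∕sixth centred moments `≤ M₄, M₆`, for every `R > 0`,
`|∫f₁f₂f₃f₄ dν| ≤ R²·Σ_w(Dᵀa₁)_w((Dᵀa₂)_w+(Dᵀa₃)_w+(Dᵀa₄)_w)∕c_w + (4M₄ + 4M₆)∕R`. [folklore] -/
theorem group_cov_one_three_le
    (hP : ∀ x F ω, P x F ω = (∫ s, F (update ω x s) * exp (-V (update ω x s))) / ∫ s, exp (-V (update ω x s)))
    (hV : ∀ x ω, HasDerivAt (fun s => V (update ω x s)) (V₁ x ω) (ω x))
    (hfloor : ∀ x ω s t, c x * (s - t) ^ 2 ≤ (V₁ x (update ω x s) - V₁ x (update ω x t)) * (s - t)) (hc : ∀ x, 0 < c x)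
    (hceil : ∀ x ω s t, |V₁ x (update ω x s) - V₁ x (update ω x t)| ≤ Cw * |s - t|)
    (hcross : ∀ x z, z ≠ x → ∀ ω s t, |V₁ x (update ω z s) - V₁ x (update ω z t)| ≤ J x z * |s - t|) (hVc : Continuous V)
    (hV0 : Integrable (fun ω : ι → ℝ => exp (-V ω))) (hV2 : ∀ z, Integrable (fun ω : ι → ℝ => ω z ^ 2 * exp (-V ω)))
    (hJ : ∀ x z, 0 ≤ J x z) (hJ0 : ∀ x, J x x = 0) (hrow : ∀ x, ∑ z, J x z / c x ≤ γ) (hγ0 : 0 ≤ γ) (hγ1 : γ < 1)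
    (hD : ∀ x y, 0 ≤ D x y) (hDC : ∀ x y, (if x = y then (1 : ℝ) else 0) + ∑ z, D x z * (J z y / c z) ≤ D x y)
    (h1 : ∀ z ω s t, |F₁ (update ω z s) - F₁ (update ω z t)| ≤ a₁ z * |s - t|)
    (h2 : ∀ z ω s t, |F₂ (update ω z s) - F₂ (update ω z t)| ≤ a₂ z * |s - t|)
    (h3 : ∀ z ω s t, |F₃ (update ω z s) - F₃ (update ω z t)| ≤ a₃ z * |s - t|)
    (h4 : ∀ z ω s t, |F₄ (update ω z s) - F₄ (update ω z t)| ≤ a₄ z * |s - t|) (m₂ m₃ m₄ : ℝ) {R M₄ M₆ : ℝ} (hR : 0 < R)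
    (hq1 : Integrable (fun ω => (F₁ ω - ∫ ω', F₁ ω' ∂((volume : Measure (ι → ℝ)).tilted fun ω => -V ω)) ^ 4) ((volume : Measure (ι → ℝ)).tilted fun ω
        => -V ω))
    (hs1 : Integrable (fun ω => (F₁ ω - ∫ ω', F₁ ω' ∂((volume : Measure (ι → ℝ)).tilted fun ω => -V ω)) ^ 6) ((volume : Measure (ι → ℝ)).tilted fun ω
        => -V ω))
    (hq2 : Integrable (fun ω => (F₂ ω - m₂) ^ 4) ((volume : Measure (ι → ℝ)).tilted fun ω => -V ω))
    (hs2 : Integrable (fun ω => (F₂ ω - m₂) ^ 6) ((volume : Measure (ι → ℝ)).tilted fun ω => -V ω))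
    (hq3 : Integrable (fun ω => (F₃ ω - m₃) ^ 4) ((volume : Measure (ι → ℝ)).tilted fun ω => -V ω))
    (hs3 : Integrable (fun ω => (F₃ ω - m₃) ^ 6) ((volume : Measure (ι → ℝ)).tilted fun ω => -V ω))
    (hq4 : Integrable (fun ω => (F₄ ω - m₄) ^ 4) ((volume : Measure (ι → ℝ)).tilted fun ω => -V ω))
    (hs4 : Integrable (fun ω => (F₄ ω - m₄) ^ 6) ((volume : Measure (ι → ℝ)).tilted fun ω => -V ω))
    (hM41 : ∫ ω, (F₁ ω - ∫ ω', F₁ ω' ∂((volume : Measure (ι → ℝ)).tilted fun ω => -V ω)) ^ 4 ∂((volume : Measure (ι → ℝ)).tilted fun ω => -V ω) ≤ M₄)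
    (hM61 : ∫ ω, (F₁ ω - ∫ ω', F₁ ω' ∂((volume : Measure (ι → ℝ)).tilted fun ω => -V ω)) ^ 6 ∂((volume : Measure (ι → ℝ)).tilted fun ω => -V ω) ≤ M₆)
    (hM42 : ∫ ω, (F₂ ω - m₂) ^ 4 ∂((volume : Measure (ι → ℝ)).tilted fun ω => -V ω) ≤ M₄) (hM62 : ∫ ω, (F₂ ω - m₂) ^ 6 ∂((volume : Measure (ι →
        ℝ)).tilted fun ω => -V ω) ≤ M₆)
    (hM43 : ∫ ω, (F₃ ω - m₃) ^ 4 ∂((volume : Measure (ι → ℝ)).tilted fun ω => -V ω) ≤ M₄) (hM63 : ∫ ω, (F₃ ω - m₃) ^ 6 ∂((volume : Measure (ι →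
        ℝ)).tilted fun ω => -V ω) ≤ M₆)
    (hM44 : ∫ ω, (F₄ ω - m₄) ^ 4 ∂((volume : Measure (ι → ℝ)).tilted fun ω => -V ω) ≤ M₄) (hM64 : ∫ ω, (F₄ ω - m₄) ^ 6 ∂((volume : Measure (ι →
        ℝ)).tilted fun ω => -V ω) ≤ M₆) :
    |∫ ω, (F₁ ω - ∫ ω', F₁ ω' ∂((volume : Measure (ι → ℝ)).tilted fun ω => -V ω)) * (F₂ ω - m₂) * (F₃ ω - m₃) * (F₄ ω - m₄)
        ∂((volume : Measure (ι → ℝ)).tilted fun ω => -V ω)| ≤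
      R ^ 2 * (∑ w, (∑ z, D z w * a₁ z) * ((∑ z, D z w * a₂ z) + (∑ z, D z w * a₃ z) + ∑ z, D z w * a₄ z) / c w) + (4 * M₄ + 4 * M₆) / R := by
  set ν : Measure (ι → ℝ) := (volume : Measure (ι → ℝ)).tilted fun ω => -V ω with hν
  haveI : IsProbabilityMeasure ν := isProbabilityMeasure_tilted hV0
  have hμ2 : ∀ z, MemLp (fun ω : ι → ℝ => ω z) 2 ν := memLp_coord_tilted hV0 hV2
  set mF : ℝ := ∫ ω', F₁ ω' ∂ν with hmF
  have hm1 : Measurable fun ω => F₁ ω - mF := (SupCoordinateLipschitzClass.measurable h1).sub_const mF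
  have hm2 : Measurable fun ω => F₂ ω - m₂ := (SupCoordinateLipschitzClass.measurable h2).sub_const m₂
  have hm3 : Measurable fun ω => F₃ ω - m₃ := (SupCoordinateLipschitzClass.measurable h3).sub_const m₃
  have hm4 : Measurable fun ω => F₄ ω - m₄ := (SupCoordinateLipschitzClass.measurable h4).sub_const m₄
  -- the defect
  have hdef := single_expect_defect_le (μ := ν) (f := fun ω => F₁ ω - mF) (g := fun ω => F₂ ω - m₂) (h := fun ω => F₃ ω - m₃)
    (k := fun ω => F₄ ω - m₄) hm1 hm2 hm3 hm4 hR hq1 hq2 hq3 hq4 hs1 hs2 hs3 hs4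
  -- the truncated pairing is a covariance: `∫(F₁ − mF)Y′ = ∫F₁Y′ − mF∫Y′`
  have hY := clamped_triple_lipVec h2 h3 h4 m₂ m₃ m₄ hR.le
  have hIF : Integrable F₁ ν := SupCoordinateLipschitzClass.integrable h1 hμ2
  have hIFY : Integrable (fun ω => F₁ ω * (max (-R) (min R (F₂ ω - m₂)) * max (-R) (min R (F₃ ω - m₃)) * max (-R) (min R (F₄ ω - m₄)))) ν :=
    SupCoordinateLipschitzClass.integrable_mul h1 hY hμ2
  have hIY : Integrable (fun ω => max (-R) (min R (F₂ ω - m₂)) * max (-R) (min R (F₃ ω - m₃)) * max (-R) (min R (F₄ ω - m₄))) ν :=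
    SupCoordinateLipschitzClass.integrable hY hμ2
  have ecov : ∫ ω, (F₁ ω - mF) * (max (-R) (min R (F₂ ω - m₂)) * max (-R) (min R (F₃ ω - m₃)) * max (-R) (min R (F₄ ω - m₄))) ∂ν =
      (∫ ω, F₁ ω * (max (-R) (min R (F₂ ω - m₂)) * max (-R) (min R (F₃ ω - m₃)) * max (-R) (min R (F₄ ω - m₄))) ∂ν) -
        (∫ ω', F₁ ω' ∂ν) * ∫ ω, max (-R) (min R (F₂ ω - m₂)) * max (-R) (min R (F₃ ω - m₃)) * max (-R) (min R (F₄ ω - m₄)) ∂ν := by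
    have e1 : ∀ ω, (F₁ ω - mF) * (max (-R) (min R (F₂ ω - m₂)) * max (-R) (min R (F₃ ω - m₃)) * max (-R) (min R (F₄ ω - m₄))) =
        F₁ ω * (max (-R) (min R (F₂ ω - m₂)) * max (-R) (min R (F₃ ω - m₃)) * max (-R) (min R (F₄ ω - m₄))) -
          mF * (max (-R) (min R (F₂ ω - m₂)) * max (-R) (min R (F₃ ω - m₃)) * max (-R) (min R (F₄ ω - m₄))) := fun ω => by ring
    simp_rw [e1]
    rw [integral_sub hIFY (hIY.const_mul _), integral_const_mul]
  have hT := single_clamped_triple_cov_le hP hV hfloor hc hceil hcross hVc hV0 hV2 hJ hJ0 hrow hγ0 hγ1 hD hDC h1 h2 h3 h4 m₂ m₃ m₄ hR.le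
  rw [← ecov] at hT
  -- assemble
  have hbig : |(∫ ω, (F₁ ω - mF) * (F₂ ω - m₂) * (F₃ ω - m₃) * (F₄ ω - m₄) ∂ν) -
      ∫ ω, (F₁ ω - mF) * (max (-R) (min R (F₂ ω - m₂)) * max (-R) (min R (F₃ ω - m₃)) * max (-R) (min R (F₄ ω - m₄))) ∂ν| ≤ (4 * M₄ + 4 * M₆) / R :=
          by
    refine hdef.trans (div_le_div_of_nonneg_right ?_ hR.le)
    linarith
  have tri := abs_sub_abs_le_abs_sub (∫ ω, (F₁ ω - mF) * (F₂ ω - m₂) * (F₃ ω - m₃) * (F₄ ω - m₄) ∂ν)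
    (∫ ω, (F₁ ω - mF) * (max (-R) (min R (F₂ ω - m₂)) * max (-R) (min R (F₃ ω - m₃)) * max (-R) (min R (F₄ ω - m₄))) ∂ν)
  linarith

/-! ## §4. Toy -/

/-- Toy (§1 with `R = 1`, `b = c = d = 0`): no defect. -/
example : |(0 : ℝ) * 0 * 0 - max (-1) (min 1 0) * max (-1) (min 1 0) * max (-1) (min 1 0)| ≤ (0 ^ 2 * |(0 : ℝ)| * |(0 : ℝ)| + |(0 : ℝ)| * 0 ^ 2 * |(0
    : ℝ)| +
    |(0 : ℝ)| * |(0 : ℝ)| * 0 ^ 2) / 1 :=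
  triple_sub_clamp_triple_abs_le one_pos 0 0 0

end Summit.QuantumFields.BalabanUV.T4Continuum.NE7b.SupTruncationSingleCut

end
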